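import Summits.CriticalPhenomena.PercolationContinuityZ3.Theorems.PercNearOneGluingNoHeavyLowerTailSahiTransportSigma

/-!
# `NoHeavyLowerTail` (crux stmt-CriticalPhenomena-4575), Sahi / Kahn positivity: TRANSPORT CERTIFICATES (V) — the TRACE REDUCTION

Support file (cell `prim-l12`, seat P3, gen 8; `--supports stmt-CriticalPhenomena-4575`).  No `sorry`, no named facts, standard axioms.
New mathematics (this programme).

A reduced certificate `ρ` (`…SahiTransportRho.RhoCert`) lives on the pattern event `H_k`; the rows (o) and (TC) are indexed by (pairs of)
up-sets `𝒳` of the whole pattern cube, but `ρ` sees only the TRACE `H_k ∩ 𝒳`.  For an up-set `𝒳` the largest family with the same trace is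
  `hat H_k 𝒳 = {S : every T ⊇ S with T ∈ H_k lies in 𝒳}`,
again an up-set, with `𝒳 ⊆ hat 𝒳` and `H_k ∩ hat 𝒳 = H_k ∩ 𝒳` (`subset_hat`, `inter_hat`).  Since the right-hand side of (TC), rewritten as
`(2−θ)w(H_k∩𝒳∩𝒵) + θ·w(𝒳)w(𝒵) − w(𝒳)w(H_k∩𝒵) − w(𝒵)w(H_k∩𝒳)`, is ANTITONE in `w(𝒳)` and in `w(𝒵)` on the relevant range (two Harris
inequalities), and `w(H_kᶜ ∩ 𝒳) ≤ w(H_kᶜ ∩ hat 𝒳)`, both (o) and (TC) need only be verified on TRACE-MAXIMAL families: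
**`rhoCert_of_hat`**.  This shrinks certificate verification from pairs of up-sets of `2^{Fin k}` (`M(k)²`, e.g. `7581²` at `k = 5`) to pairs
of up-sets of the poset `(H_k, ⊆)`; for the all-but-one event `Th_{k−1}^k` the trace-maximal families are the `2^k` cylinders
(`…SahiAllButOneCylinders`), which is how the all-but-one slot theorem is proved. [this work]
-/

noncomputable section

open scoped Classical

namespace Summit.CriticalPhenomena.PercolationContinuityZ3.Theorems

namespace SahiTransportCert

open Finset
open SahiHittingSlot
open Literature.Combinatorics.Sahi2008
open Literature.Probability.Percolation.BHK2006 (ind_inter)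
open Literature.Probability.Percolation.DecisionTree (ind ind_of_mem ind_of_not_mem ind_nonneg)

variable {k : ℕ}

/-! ### Trace-maximal families -/

/-- The TRACE-MAXIMAL family of `𝒳`: patterns all of whose completions in `Hk` lie in `𝒳`. [this work] -/
def hat (Hk 𝒳 : Set (Set (Fin k))) : Set (Set (Fin k)) := {S | ∀ T, S ⊆ T → T ∈ Hk → T ∈ 𝒳}

/-- `hat 𝒳` is an up-set. [this work] -/
theorem isUpperSet_hat (Hk 𝒳 : Set (Set (Fin k))) : IsUpperSet (hat Hk 𝒳) :=
  fun _ _ hle hS T hT hTH => hS T (Set.Subset.trans hle hT) hTH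

/-- An up-set lies in its trace-maximal family. [this work] -/
theorem subset_hat (Hk : Set (Set (Fin k))) {𝒳 : Set (Set (Fin k))} (h𝒳 : IsUpperSet 𝒳) : 𝒳 ⊆ hat Hk 𝒳 :=
  fun _ hS _ hT _ => h𝒳 hT hS

/-- The trace-maximal family has the same trace. [this work] -/
theorem inter_hat (Hk : Set (Set (Fin k))) {𝒳 : Set (Set (Fin k))} (h𝒳 : IsUpperSet 𝒳) : Hk ∩ hat Hk 𝒳 = Hk ∩ 𝒳 := by
  ext S
  exact ⟨fun h => ⟨h.1, h.2 S Set.Subset.rfl h.1⟩, fun h => ⟨h.1, subset_hat Hk h𝒳 h.2⟩⟩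

/-- Same trace for an intersection of two families. [this work] -/
theorem inter_hat_inter_hat (Hk : Set (Set (Fin k))) {𝒳 𝒵 : Set (Set (Fin k))} (h𝒳 : IsUpperSet 𝒳) (h𝒵 : IsUpperSet 𝒵) :
    Hk ∩ (hat Hk 𝒳 ∩ hat Hk 𝒵) = Hk ∩ (𝒳 ∩ 𝒵) := by
  ext S
  constructor
  · rintro ⟨hH, hX, hZ⟩; exact ⟨hH, hX S Set.Subset.rfl hH, hZ S Set.Subset.rfl hH⟩
  · rintro ⟨hH, hX, hZ⟩; exact ⟨hH, subset_hat Hk h𝒳 hX, subset_hat Hk h𝒵 hZ⟩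

/-- A sum against `ρ` supported on `Hk` sees only the trace. [this work] -/
theorem sum_mul_ind_eq_of_inter_eq {Hk : Set (Set (Fin k))} {ρ : Set (Fin k) → ℝ} (hρH : ∀ T, T ∉ Hk → ρ T = 0)
    {𝒴 𝒴' : Set (Set (Fin k))} (h : Hk ∩ 𝒴 = Hk ∩ 𝒴') : ∑ T, ρ T * ind 𝒴 T = ∑ T, ρ T * ind 𝒴' T := by
  refine sum_congr rfl fun T _ => ?_
  by_cases hT : T ∈ Hk
  · have : T ∈ 𝒴 ↔ T ∈ 𝒴' := by
      constructor
      · intro hY; have : T ∈ Hk ∩ 𝒴 := ⟨hT, hY⟩; rw [h] at this; exact this.2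
      · intro hY; have : T ∈ Hk ∩ 𝒴' := ⟨hT, hY⟩; rw [← h] at this; exact this.2
    by_cases hY : T ∈ 𝒴
    · rw [ind_of_mem hY, ind_of_mem (this.1 hY)]
    · rw [ind_of_not_mem hY, ind_of_not_mem (fun h' => hY (this.2 h'))]
  · rw [hρH T hT, zero_mul, zero_mul]

/-- `tcRHS` through traces: `tcRHS = (2−θ)w(Hk∩𝒳∩𝒵) + θ w(𝒳)w(𝒵) − w(𝒳)w(Hk∩𝒵) − w(𝒵)w(Hk∩𝒳)`. [this work] -/
theorem tcRHS_eq (q : Fin k → unitInterval) (Hk 𝒳 𝒵 : Set (Set (Fin k))) :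
    tcRHS q Hk 𝒳 𝒵 = (2 - pr q Hk) * pr q (Hk ∩ (𝒳 ∩ 𝒵)) + pr q Hk * (pr q 𝒳 * pr q 𝒵)
      - pr q 𝒳 * pr q (Hk ∩ 𝒵) - pr q 𝒵 * pr q (Hk ∩ 𝒳) := by
  rw [tcRHS, pr_compl_inter, pr_compl_inter, pr_compl_inter]; ring

/-- **MONOTONICITY OF (TC).**  The right-hand side of (TC) does not increase when `𝒳, 𝒵` are replaced by larger up-sets with the same traces
on `Hk`. [this work] -/
theorem tcRHS_mono (q : Fin k → unitInterval) {Hk 𝒳 𝒵 𝒳' 𝒵' : Set (Set (Fin k))} (hHk : IsUpperSet Hk) (h𝒳 : IsUpperSet 𝒳)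
    (h𝒵' : IsUpperSet 𝒵') (hX : 𝒳 ⊆ 𝒳') (hZ : 𝒵 ⊆ 𝒵') (htX : Hk ∩ 𝒳' = Hk ∩ 𝒳) (htZ : Hk ∩ 𝒵' = Hk ∩ 𝒵)
    (htXZ : Hk ∩ (𝒳' ∩ 𝒵') = Hk ∩ (𝒳 ∩ 𝒵)) : tcRHS q Hk 𝒳' 𝒵' ≤ tcRHS q Hk 𝒳 𝒵 := by
  rw [tcRHS_eq, tcRHS_eq, htX, htZ, htXZ]
  have hx : pr q 𝒳 ≤ pr q 𝒳' := pr_mono q hX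
  have hz : pr q 𝒵 ≤ pr q 𝒵' := pr_mono q hZ
  -- Harris: `w(Hk ∩ 𝒵') ≥ θ w(𝒵')` and `w(Hk ∩ 𝒳) ≥ θ w(𝒳)`
  have hHZ : pr q Hk * pr q 𝒵' ≤ pr q (Hk ∩ 𝒵) := by rw [← htZ]; exact pr_mul_pr_le_pr_inter q hHk h𝒵'
  have hHX : pr q Hk * pr q 𝒳 ≤ pr q (Hk ∩ 𝒳) := pr_mul_pr_le_pr_inter q hHk h𝒳
  have e1 : 0 ≤ (pr q 𝒳' - pr q 𝒳) * (pr q (Hk ∩ 𝒵) - pr q Hk * pr q 𝒵') := mul_nonneg (by linarith) (by linarith)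
  have e2 : 0 ≤ (pr q 𝒵' - pr q 𝒵) * (pr q (Hk ∩ 𝒳) - pr q Hk * pr q 𝒳) := mul_nonneg (by linarith) (by linarith)
  nlinarith [e1, e2]

/-- **THE TRACE REDUCTION.**  A probability vector on `Hk` satisfying the capacity bound (a), and the rows (o), (TC) for the TRACE-MAXIMAL
up-sets only, is a reduced transport certificate. [this work] -/
theorem rhoCert_of_hat {q : Fin k → unitInterval} {Hk : Set (Set (Fin k))} {ρ : Set (Fin k) → ℝ} (hHk : IsUpperSet Hk)
    (h0 : ∀ T, 0 ≤ ρ T) (hH : ∀ T, T ∉ Hk → ρ T = 0) (h1 : ∑ T, ρ T = 1)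
    (ha : ∀ T, pr q Hk * (1 - pr q Hk) * ρ T ≤ (2 - pr q Hk) * bernoulliWeight q T)
    (ho : ∀ 𝒯 : Set (Set (Fin k)), IsUpperSet 𝒯 → pr q (Hkᶜ ∩ hat Hk 𝒯) ≤ (1 - pr q Hk) * ∑ T, ρ T * ind (hat Hk 𝒯) T)
    (htc : ∀ 𝒳 𝒵 : Set (Set (Fin k)), IsUpperSet 𝒳 → IsUpperSet 𝒵 →
      pr q Hk * (1 - pr q Hk) * ∑ T, ρ T * ind (hat Hk 𝒳 ∩ hat Hk 𝒵) T ≤ tcRHS q Hk (hat Hk 𝒳) (hat Hk 𝒵)) :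
    RhoCert q Hk ρ := by
  refine ⟨h0, hH, h1, ha, fun 𝒯 h𝒯 => ?_, fun 𝒳 𝒵 h𝒳 h𝒵 => ?_⟩
  · -- (o): `w(Hkᶜ ∩ 𝒯) ≤ w(Hkᶜ ∩ hat 𝒯)` and equal traces
    have htr := inter_hat Hk h𝒯
    have hsum : ∑ T, ρ T * ind 𝒯 T = ∑ T, ρ T * ind (hat Hk 𝒯) T := sum_mul_ind_eq_of_inter_eq hH htr.symm
    rw [hsum]
    refine le_trans ?_ (ho 𝒯 h𝒯)
    rw [pr_compl_inter, pr_compl_inter, htr]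
    linarith [pr_mono q (subset_hat Hk h𝒯)]
  · -- (TC): equal traces on the left, monotonicity on the right
    have htr := inter_hat_inter_hat Hk h𝒳 h𝒵
    have hsum : ∑ T, ρ T * ind (𝒳 ∩ 𝒵) T = ∑ T, ρ T * ind (hat Hk 𝒳 ∩ hat Hk 𝒵) T := sum_mul_ind_eq_of_inter_eq hH htr.symm
    rw [hsum]
    refine le_trans (htc 𝒳 𝒵 h𝒳 h𝒵) ?_
    exact tcRHS_mono q hHk h𝒳 (isUpperSet_hat Hk 𝒵) (subset_hat Hk h𝒳) (subset_hat Hk h𝒵) (inter_hat Hk h𝒳) (inter_hat Hk h𝒵) htr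

end SahiTransportCert

end Summit.CriticalPhenomena.PercolationContinuityZ3.Theorems
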